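import Literature.NumberTheory.Automorphic.SymplecticBorelTwistedModulusIndex
import Literature.NumberTheory.Automorphic.SymplecticSimilitudeSatakeTransformDuality
import HarnessLib

/-!
# The modulus index of the Borel subgroup of `GSp_{2n}` evaluated: `[B(𝒪) : B(𝒪) ∩ t_λB(𝒪)t_λ⁻¹] = q^{⟨ρ, w₀α⟩ - ⟨ρ, α⟩}`
# (`λ = (α, c)` antidominant, `w₀α = c·1 - α`), the index ratio for every `λ`, the counting duality with `q` explicit, and
# the EXACT `w₀`-invariance `𝒮_q(T)_{(c·1-α, c)} = 𝒮_q(T)_{(α, c)}` of the Satake transform of `ℋ(GSp_{2n}(K), GSp_{2n}(𝒪); R)`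
# for every `n` (Andrianov–Zhuravlev Ch. 3 §3.3 Thm. 3.30; Cartier §IV Thm. 4.1; Macdonald V (2.6))

Topic `NumberTheory/Automorphic`; namespace `Literature.NumberTheory.Automorphic.SymplecticCartan` (lane `lit-hodgefound`,
Track 2 foundations; seat `lit-hodgefound-p11`, generation 45, row g45-#6).  THEOREMS ONLY: no definition, no named fact, no
instance, no notation.  Sequel of `SymplecticBorelTwistedModulusIndex` (g45-#5: `ρ_c`, `N^{(m)}(ν)` and the twisted index
`[B(𝒪) : B(𝒪) ∩ ρ_{ϖ^m}(t_aB(𝒪)t_a⁻¹)] = q^{-2⟨ρ,a⟩ - ⟨ρ,m·1⟩}` in `Sp_{2n}`) and `SymplecticSimilitudeSatakeTransformDuality` (g44-#6: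
the `w₀`-duality of `GSp_{2n}` with the indices `[K_P : K_P ∩ t_λK_Pt_λ⁻¹]` left abstract).  Here the indices are EVALUATED.

## The mathematics

`G = GSp(J, K)` over a discretely valued field `K` (`q = #𝓀`, uniformiser `ϖ`), `K₀ = GSp(J, 𝒪)`, `B'(K)` its Borel subgroup
(`symplecticSimilitudeBorel`), `K_P = B'(𝒪)`; `λ = (α, c) ∈ ℤⁿ × ℤ = X_*`, `t_λ = t(c, α - c·1) = diag(ϖ^c·1; 1) · ι(t_{α-c·1})
= diag(ϖ^α; ϖ^{c-α})` (`similitudeTorusElt`), `w₀λ = (c·1 - α, c)`, `E(λ) = ⟨ρ, c·1 - α⟩ - ⟨ρ, α⟩` (`⟨ρ, α⟩ = Σ (n-i) αᵢ`).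
(1) TRANSPORT (`relIndex_conjAct_similitudeBorelInt_eq_relIndex_map_blockRescale`): `B'(𝒪) = ι(B(𝒪))·D(𝒪)` with the unit blocks
`D(𝒪) = {diag(u·1; 1) : u ∈ 𝒪ˣ} ⊆ B'(𝒪) ∩ t_λB'(𝒪)t_λ⁻¹` (`exists_eq_ofSymplectic_mul_scalarBlockGSp`), so
`[B'(𝒪) : B'(𝒪) ∩ t_λB'(𝒪)t_λ⁻¹] = [ι(B(𝒪)) : ι(B(𝒪)) ∩ t_λB'(𝒪)t_λ⁻¹]`; `ι(Sp) = ker r` is normal and `ι(B(𝒪)) = B'(𝒪) ∩ ι(Sp)`,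
so `ι(B(𝒪)) ∩ t_λB'(𝒪)t_λ⁻¹ = ι(B(𝒪)) ∩ t_λι(B(𝒪))t_λ⁻¹`; and `t_λ ι(H) t_λ⁻¹ = ι(ρ_{ϖ^c}(t_a H t_a⁻¹))` (`a = α - c·1`), `ι`
injective: the index is the twisted index of g45-#5.  (2) EVALUATION: for `λ` ANTIDOMINANT (`α` monotone, `αᵢ + αⱼ ≤ c`;
then `t_λB'(𝒪)t_λ⁻¹ ≤ B'(𝒪)`)

  **`[B'(𝒪) : t_λB'(𝒪)t_λ⁻¹] = q^{-2⟨ρ,α-c·1⟩ - ⟨ρ,c·1⟩} = q^{⟨ρ, c·1-α⟩ - ⟨ρ, α⟩} = q^{E(λ)}`**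

(`= ∏_{i<j} q^{αⱼ-αᵢ} ∏_{i≤j} q^{c-αᵢ-αⱼ}`, the modulus `δ_{B'}(t_λ)^{-1}`; `GL₂ = GSp₂`, `λ = (0,1)`, `t_λ = diag(1, ϖ)`: `q`).
(3) For EVERY `λ` the ratio of the two indices is `q^{E(λ)}` (multiplicativity of the ratio, g44-#1, at an antidominant `λ'`
with `λ + λ'` antidominant), hence the COUNTING DUALITY WITH `q` EXPLICIT
`#{γ ∈ K₀gK₀/K₀ : (a,c)(γ) = λ}·q^{(-E(λ))⁺} = #{γ : (a,c)(γ) = w₀λ}·q^{E(λ)⁺}`.  (4) Since Andrianov–Zhuravlev's weight is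
`q^{⟨ρ,α⟩}` and `⟨ρ, w₀α⟩ = ⟨ρ, α⟩ + E(λ)`, the coefficient formula `𝒮_q(T_g)_λ = #{(a,c)(γ) = λ}·q^{⟨ρ,α⟩}` and (3) give the
EXACT `w₀`-INVARIANCE **`𝒮_q(T)_{(c·1-α, c)} = 𝒮_q(T)_{(α, c)}`** for every `n ≥ 1`, `T`, `λ`, whenever `q ∈ Rˣ` is the residue
cardinality — the `w₀`-part of A–Z Thm. 3.30 («the image of `Ω` is `ℚ[x₀, …, xₙ]^W`») over any such `R`.

## What is formalised

* §1 `conjAct_ofSymplectic_smul_map`, `conjAct_scalarBlockGSp_smul_map`, `range_ofSymplectic_normal`,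
  `ofSymplectic_mem_symplecticSimilitudeInt_iff`, `map_ofSymplectic_borelInt_eq`, `map_borelInt_inf_conjAct_eq`,
  `similitudeTorusElt_eq_scalarBlockGSp_mul_ofSymplectic`, **`relIndex_conjAct_similitudeBorelInt_eq_relIndex_map_blockRescale`**.
* §2 `symplecticRhoPairing_sub_const/_const_sub/_const_add`, `symplecticRhoPairing_const_sub_sub_nonneg`,
  **`relIndex_conjAct_similitudeBorelInt_eq_pow`**, `relIndex_similitudeBorelInt_conjAct_eq_one`,
  `coeff_satakeTransform_one_eq_pow_mul_similitude`.
* §3 **`relIndex_similitudeBorelInt_conjAct_mul_pow_eq`**, **`card_filter_similitudeIwasawaExp_mul_pow_eq`**,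
  **`card_filter_similitudeIwasawaExp_orbit_w0_eq_pow`** (`#{(a,c)(γ) = (-a, m)} = q^{2⟨ρ,a⟩+⟨ρ,m·1⟩}` on `K₀t(m,a)K₀`).
* §4 `coeff_similitudeSatakeTransform_doubleCosetOperator_w0`, **`coeff_similitudeSatakeTransform_w0`**,
  `range_similitudeSatakeTransform_subset`.

## References
* [AndrianovZhuravlev1995] A. N. Andrianov, V. G. Zhuravlev, *Modular Forms and Hecke Operators*, Transl. Math. Monogr. 145
  (1995), Ch. 1 §3 Prop. 3.7; Ch. 3 §3 (3.1), Lemma 3.6, Lemma 3.11, §3.3 (3.44)–(3.49), Thm. 3.30.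
* [CartierCorvallis1979] P. Cartier, *Representations of 𝔭-adic groups: a survey*, PSPM 33.1 (1979), §I.3, §IV (4.2), Thm. 4.1.
* [Kottwitz1992] R. E. Kottwitz, *Points on some Shimura varieties over finite fields*, J. AMS 5 (1992), §5 p. 389, §7 p. 393,
  Lemma 7.4.
* [Macdonald1995] I. G. Macdonald, *Symmetric Functions and Hall Polynomials*, 2nd ed. (1995), Ch. V (2.6)–(2.9).
* [Laumon1995] G. Laumon, *Cohomology of Drinfeld Modular Varieties I*, CUP (1996), (4.1.4)–(4.1.6).
* [BruhatTits1972] F. Bruhat, J. Tits, *Groupes réductifs sur un corps local I*, Publ. Math. IHÉS 41 (1972), (4.4.4).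
* [Tits1979] J. Tits, *Reductive groups over local fields*, PSPM 33.1 (1979), §3.3.3.
* [Satake1963] I. Satake, *Theory of spherical functions on reductive algebraic groups over 𝔭-adic fields*, Publ. Math. IHÉS
  18 (1963), §§6–7.
-/

noncomputable section

open scoped Valued WithZero Pointwise MatrixGroups
open Matrix MulAction ConjAct

namespace Literature.NumberTheory.Automorphic.SymplecticCartan

open Literature.NumberTheory.Automorphic.CartanUnique Literature.NumberTheory.Automorphic.HermitianLattice

variable {K : Type*} [Field K]

/-! ## §1 Transport of subgroups through `ι : Sp(J, K) → GSp(J, K)` -/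

section Transport

variable {l : Type*} [Fintype l] [DecidableEq l]

/-- `ι(g) ι(H) ι(g)⁻¹ = ι(gHg⁻¹)`. [cite: AndrianovZhuravlev1995, Ch. 3 §3] -/
theorem conjAct_ofSymplectic_smul_map (g : symplecticGroup l K) (H : Subgroup (symplecticGroup l K)) :
    toConjAct (ofSymplectic g) • H.map (ofSymplectic : symplecticGroup l K →* symplecticSimilitudeGroup l K) =
      (toConjAct g • H).map ofSymplectic := by
  ext x
  rw [Subgroup.mem_smul_pointwise_iff_exists, Subgroup.mem_map]
  constructor
  · rintro ⟨y, hy, rfl⟩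
    obtain ⟨h, hh, rfl⟩ := Subgroup.mem_map.1 hy
    refine ⟨toConjAct g • h, Subgroup.smul_mem_pointwise_smul _ _ _ hh, ?_⟩
    rw [toConjAct_smul, toConjAct_smul, map_mul, map_mul, map_inv]
  · rintro ⟨y, hy, rfl⟩
    rw [Subgroup.mem_smul_pointwise_iff_exists] at hy
    obtain ⟨h, hh, rfl⟩ := hy
    exact ⟨ofSymplectic h, Subgroup.mem_map.2 ⟨h, hh, rfl⟩, by rw [toConjAct_smul, toConjAct_smul, map_mul, map_mul, map_inv]⟩

/-- `s_c ι(H) s_c⁻¹ = ι(ρ_c(H))` for the similitude `s_c = diag(c·1; 1)`. [cite: AndrianovZhuravlev1995, Ch. 3 §3 Lemma 3.6] -/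
theorem conjAct_scalarBlockGSp_smul_map {c : K} (hc : c ≠ 0) (H : Subgroup (symplecticGroup l K)) :
    toConjAct (scalarBlockGSp c hc : symplecticSimilitudeGroup l K) •
        H.map (ofSymplectic : symplecticGroup l K →* symplecticSimilitudeGroup l K) =
      (H.map (blockRescale hc)).map ofSymplectic := by
  ext x
  rw [Subgroup.mem_smul_pointwise_iff_exists, Subgroup.map_map, Subgroup.mem_map]
  constructor
  · rintro ⟨y, hy, rfl⟩
    obtain ⟨h, hh, rfl⟩ := Subgroup.mem_map.1 hy
    exact ⟨h, hh, by rw [MonoidHom.comp_apply, ofSymplectic_blockRescale, toConjAct_smul]⟩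
  · rintro ⟨h, hh, rfl⟩
    exact ⟨ofSymplectic h, Subgroup.mem_map.2 ⟨h, hh, rfl⟩, by rw [MonoidHom.comp_apply, ofSymplectic_blockRescale, toConjAct_smul]⟩

/-- `ι(Sp(J, K)) = ker r` is normal in `GSp(J, K)`. [cite: Kottwitz1992, §5 p. 389] [cite: AndrianovZhuravlev1995, Ch. 3 §3 (3.1)] -/
theorem range_ofSymplectic_normal [Nonempty l] :
    ((ofSymplectic : symplecticGroup l K →* symplecticSimilitudeGroup l K).range).Normal := by
  rw [← ker_multiplierHom_eq_range_ofSymplectic]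
  infer_instance

variable [Valued K ℤᵐ⁰] {ϖ : K}

/-- `ι(A) ∈ GSp(J, 𝒪) ↔ A ∈ Sp(J, 𝒪)`. [cite: Tits1979, §3.3.3] -/
theorem ofSymplectic_mem_symplecticSimilitudeInt_iff {A : symplecticGroup l K} :
    ofSymplectic A ∈ symplecticSimilitudeInt l K ↔ A ∈ symplecticInt l K := by
  refine ⟨fun h => mem_symplecticInt_iff.2 fun i j => ?_, ofSymplectic_mem_symplecticSimilitudeInt⟩
  have h' := (mem_symplecticSimilitudeInt_iff.1 h).1 i j
  rwa [coe_ofSymplectic] at h'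

variable {n : ℕ}

/-- **`ι(B(𝒪)) = B'(𝒪) ∩ ι(Sp)`**: an `Sp`-element lies in the integral Borel of `GSp` iff it lies in that of `Sp`
(`B' = ` Borel of `GSp`, `B` = Borel of `Sp`). [cite: AndrianovZhuravlev1995, Ch. 1 §3 Prop. 3.7; Ch. 3 §3 Lemma 3.11] -/
theorem map_ofSymplectic_borelInt_eq :
    (symplecticBorel n K ⊓ symplecticInt (Fin n) K).map (ofSymplectic : symplecticGroup (Fin n) K →* _) =
      (symplecticSimilitudeBorel n K ⊓ symplecticSimilitudeInt (Fin n) K) ⊓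
        (ofSymplectic : symplecticGroup (Fin n) K →* symplecticSimilitudeGroup (Fin n) K).range := by
  ext x
  constructor
  · rintro ⟨A, hA, rfl⟩
    obtain ⟨hAB, hAK⟩ := Subgroup.mem_inf.1 hA
    exact Subgroup.mem_inf.2 ⟨Subgroup.mem_inf.2 ⟨ofSymplectic_mem_symplecticSimilitudeBorel_iff.2 hAB,
      ofSymplectic_mem_symplecticSimilitudeInt hAK⟩, ⟨A, rfl⟩⟩
  · rintro ⟨hx, ⟨A, rfl⟩⟩
    obtain ⟨hB, hK⟩ := Subgroup.mem_inf.1 hx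
    exact ⟨A, Subgroup.mem_inf.2 ⟨ofSymplectic_mem_symplecticSimilitudeBorel_iff.1 hB,
      ofSymplectic_mem_symplecticSimilitudeInt_iff.1 hK⟩, rfl⟩

/-- **`ι(B(𝒪)) ∩ tB'(𝒪)t⁻¹ = ι(B(𝒪)) ∩ tι(B(𝒪))t⁻¹`** for every `t ∈ GSp(J, K)` (`ι(Sp)` is normal).
[cite: CartierCorvallis1979, §I.3] [cite: Kottwitz1992, §5 p. 389] -/
theorem map_borelInt_inf_conjAct_eq [NeZero n] (t : symplecticSimilitudeGroup (Fin n) K) :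
    (symplecticBorel n K ⊓ symplecticInt (Fin n) K).map (ofSymplectic : symplecticGroup (Fin n) K →* _) ⊓
        toConjAct t • (symplecticSimilitudeBorel n K ⊓ symplecticSimilitudeInt (Fin n) K) =
      (symplecticBorel n K ⊓ symplecticInt (Fin n) K).map (ofSymplectic : symplecticGroup (Fin n) K →* _) ⊓
        toConjAct t • (symplecticBorel n K ⊓ symplecticInt (Fin n) K).map (ofSymplectic : symplecticGroup (Fin n) K →* _) := by
  haveI : Nonempty (Fin n) := ⟨0⟩
  have hN := range_ofSymplectic_normal (l := Fin n) (K := K)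
  rw [map_ofSymplectic_borelInt_eq,
    Subgroup.smul_inf (toConjAct t) (symplecticSimilitudeBorel n K ⊓ symplecticSimilitudeInt (Fin n) K)
      (ofSymplectic : symplecticGroup (Fin n) K →* symplecticSimilitudeGroup (Fin n) K).range, hN.conjAct (toConjAct t)]
  exact le_antisymm (le_inf inf_le_left (le_inf inf_le_right (inf_le_left.trans inf_le_right))) (inf_le_inf_left _ inf_le_left)

omit [Valued K ℤᵐ⁰] in
/-- `t(c, a) = diag(ϖ^c·1; 1) · ι(t_a)` for any `t_a ∈ Sp` with matrix `diag(ϖ^a; ϖ^{-a})`. [cite: AndrianovZhuravlev1995, Ch. 3 §3 Lemma 3.6]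
[cite: Kottwitz1992, §7 Lemma 7.4] -/
theorem similitudeTorusElt_eq_scalarBlockGSp_mul_ofSymplectic (hϖ0 : ϖ ≠ 0) {t : symplecticGroup (Fin n) K}
    {a : Fin n → ℤ} (ht : (t : Matrix (Fin n ⊕ Fin n) (Fin n ⊕ Fin n) K) = Matrix.diagonal fun s => ϖ ^ Sum.elim a (-a) s)
    (c : ℤ) :
    (similitudeTorusElt hϖ0 c a : symplecticSimilitudeGroup (Fin n) K) =
      scalarBlockGSp (ϖ ^ c) (zpow_ne_zero c hϖ0) * ofSymplectic t := by
  change scalarBlockGSp (ϖ ^ c) (zpow_ne_zero c hϖ0) * ofSymplectic _ = _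
  congr 2
  refine Subtype.ext ?_
  rw [ht]
  change Matrix.diagonal _ = _
  congr 1
  funext s
  rcases s with i | i <;> rfl

/-- **Transport of the modulus index to `Sp_{2n}`**: for `t(c, a) = diag(ϖ^c ϖ^a; ϖ^{-a}) ∈ GSp_{2n}(K)`,
`[B'(𝒪) : B'(𝒪) ∩ t(c,a)B'(𝒪)t(c,a)⁻¹] = [B(𝒪) : B(𝒪) ∩ ρ_{ϖ^c}(t_aB(𝒪)t_a⁻¹)]` (`B'(𝒪) = ι(B(𝒪))·D(𝒪)` with the unit
blocks `D(𝒪) = {diag(u·1; 1)} ⊆ B'(𝒪) ∩ tB'(𝒪)t⁻¹`, `ι(Sp)` normal, `Int(t) ∘ ι = ι ∘ ρ_{ϖ^c} ∘ Int(t_a)`, `ι` injective).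
[cite: CartierCorvallis1979, §I.3, §IV (4.2)] [cite: Kottwitz1992, §7 p. 393] [cite: AndrianovZhuravlev1995, Ch. 3 §3 Lemma 3.6] -/
theorem relIndex_conjAct_similitudeBorelInt_eq_relIndex_map_blockRescale (hϖ : Valued.v ϖ = WithZero.exp (-1 : ℤ)) [NeZero n]
    {t : symplecticGroup (Fin n) K} {a : Fin n → ℤ}
    (ht : (t : Matrix (Fin n ⊕ Fin n) (Fin n ⊕ Fin n) K) = Matrix.diagonal fun s => ϖ ^ Sum.elim a (-a) s) (c : ℤ) :
    (toConjAct (similitudeTorusElt (uniformizer_ne_zero hϖ) c a : symplecticSimilitudeGroup (Fin n) K) •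
          (symplecticSimilitudeBorel n K ⊓ symplecticSimilitudeInt (Fin n) K)).relIndex
        (symplecticSimilitudeBorel n K ⊓ symplecticSimilitudeInt (Fin n) K) =
      ((toConjAct t • (symplecticBorel n K ⊓ symplecticInt (Fin n) K)).map
          (blockRescale (zpow_ne_zero c (uniformizer_ne_zero hϖ)))).relIndex (symplecticBorel n K ⊓ symplecticInt (Fin n) K) := by
  haveI : Nonempty (Fin n) := ⟨0⟩
  have hϖ0 := uniformizer_ne_zero hϖ
  -- Step A: `B'(𝒪) ⊆ ι(B(𝒪)) · (t B'(𝒪) t⁻¹)`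
  have hUL : (symplecticBorel n K ⊓ symplecticInt (Fin n) K).map (ofSymplectic : symplecticGroup (Fin n) K →* _) ≤
      symplecticSimilitudeBorel n K ⊓ symplecticSimilitudeInt (Fin n) K := by
    rw [map_ofSymplectic_borelInt_eq]; exact inf_le_left
  have hsub : ((symplecticSimilitudeBorel n K ⊓ symplecticSimilitudeInt (Fin n) K :
      Subgroup (symplecticSimilitudeGroup (Fin n) K)) : Set (symplecticSimilitudeGroup (Fin n) K)) ⊆
        (((symplecticBorel n K ⊓ symplecticInt (Fin n) K).map (ofSymplectic : symplecticGroup (Fin n) K →* _) :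
          Subgroup (symplecticSimilitudeGroup (Fin n) K)) : Set (symplecticSimilitudeGroup (Fin n) K)) *
        ((toConjAct (similitudeTorusElt hϖ0 c a : symplecticSimilitudeGroup (Fin n) K) •
            (symplecticSimilitudeBorel n K ⊓ symplecticSimilitudeInt (Fin n) K) : Subgroup (symplecticSimilitudeGroup (Fin n) K)) :
          Set (symplecticSimilitudeGroup (Fin n) K)) := by
    intro k hk
    obtain ⟨hkB, hkK⟩ := Subgroup.mem_inf.1 hk
    obtain ⟨S, hS, hkS⟩ := exists_eq_ofSymplectic_mul_scalarBlockGSp hkK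
    have hu1 : Valued.v (multiplier k : K) = 1 := v_multiplier_eq_one_of_mem_symplecticSimilitudeInt hkK
    set u : symplecticSimilitudeGroup (Fin n) K := scalarBlockGSp (multiplier k : K) (multiplier k).ne_zero with hu
    have huB : u ∈ symplecticSimilitudeBorel n K := scalarBlockGSp_mem_symplecticSimilitudeBorel _ _
    have huK : u ∈ symplecticSimilitudeInt (Fin n) K := scalarBlockGSp_mem_symplecticSimilitudeInt hu1
    have hSB : S ∈ symplecticBorel n K := by
      have e : ofSymplectic S = k * u⁻¹ := by rw [hkS, mul_inv_cancel_right]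
      rw [← ofSymplectic_mem_symplecticSimilitudeBorel_iff, e]
      exact (symplecticSimilitudeBorel n K).mul_mem hkB ((symplecticSimilitudeBorel n K).inv_mem huB)
    have hcomm : u * similitudeTorusElt hϖ0 c a = similitudeTorusElt hϖ0 c a * u := by
      refine Subtype.ext (Units.ext ?_)
      rw [Subgroup.coe_mul, Units.val_mul, Subgroup.coe_mul, Units.val_mul, hu, coe_coe_scalarBlockGSp,
        coe_coe_similitudeTorusElt, Matrix.diagonal_mul_diagonal, Matrix.diagonal_mul_diagonal]
      congr 1
      funext s
      exact mul_comm _ _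
    have huT : u ∈ toConjAct (similitudeTorusElt hϖ0 c a : symplecticSimilitudeGroup (Fin n) K) •
        (symplecticSimilitudeBorel n K ⊓ symplecticSimilitudeInt (Fin n) K) := by
      rw [Subgroup.mem_pointwise_smul_iff_inv_smul_mem, ← toConjAct_inv, toConjAct_smul, inv_inv, mul_assoc, hcomm,
        inv_mul_cancel_left]
      exact Subgroup.mem_inf.2 ⟨huB, huK⟩
    exact Set.mem_mul.2 ⟨ofSymplectic S, Subgroup.mem_map.2 ⟨S, Subgroup.mem_inf.2 ⟨hSB, hS⟩, rfl⟩, u, huT, hkS.symm⟩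
  -- Step B: intersect with `ι(Sp)` and pull back
  rw [relIndex_eq_relIndex_of_coe_subset_mul hUL hsub, ← Subgroup.inf_relIndex_left, map_borelInt_inf_conjAct_eq,
    Subgroup.inf_relIndex_left, similitudeTorusElt_eq_scalarBlockGSp_mul_ofSymplectic hϖ0 ht c, toConjAct_mul, mul_smul,
    conjAct_ofSymplectic_smul_map, conjAct_scalarBlockGSp_smul_map, Subgroup.relIndex_map_map_of_injective _ _ ofSymplectic_injective]

end Transport

/-! ## §2 The modulus index of the Borel subgroup of `GSp_{2n}` evaluated -/

section Evaluation

variable {n : ℕ}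

/-- `⟨ρ, a - c·1⟩ = ⟨ρ, a⟩ - ⟨ρ, c·1⟩`. [cite: CartierCorvallis1979, §IV (4.2)] -/
theorem symplecticRhoPairing_sub_const (a : Fin n → ℤ) (c : ℤ) :
    symplecticRhoPairing (fun i => a i - c) = symplecticRhoPairing a - symplecticRhoPairing (fun _ : Fin n => c) := by
  simp only [symplecticRhoPairing, mul_sub, Finset.sum_sub_distrib]

/-- `⟨ρ, c·1 - a⟩ = ⟨ρ, c·1⟩ - ⟨ρ, a⟩`. [cite: CartierCorvallis1979, §IV (4.2)] -/
theorem symplecticRhoPairing_const_sub (c : ℤ) (a : Fin n → ℤ) :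
    symplecticRhoPairing (fun i => c - a i) = symplecticRhoPairing (fun _ : Fin n => c) - symplecticRhoPairing a := by
  simp only [symplecticRhoPairing, mul_sub, Finset.sum_sub_distrib]

/-- `⟨ρ, (c + c')·1⟩ = ⟨ρ, c·1⟩ + ⟨ρ, c'·1⟩`. [cite: CartierCorvallis1979, §IV (4.2)] -/
theorem symplecticRhoPairing_const_add (c c' : ℤ) :
    symplecticRhoPairing (fun _ : Fin n => c + c') = symplecticRhoPairing (fun _ : Fin n => c) + symplecticRhoPairing (fun _ : Fin n => c') := by
  simp only [symplecticRhoPairing, mul_add, Finset.sum_add_distrib]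

/-- **The exponent is `≥ 0` on the antidominant cone**: for `α` monotone with `αᵢ + αⱼ ≤ c`, `⟨ρ, c·1 - α⟩ - ⟨ρ, α⟩ ≥ 0`
(a sum of the non-negative root values `αⱼ - αᵢ (i<j)`, `c - αᵢ - αⱼ (i≤j)`). [cite: CartierCorvallis1979, §IV (4.2)]
[cite: Macdonald1995, Ch. V (2.6)] -/
theorem symplecticRhoPairing_const_sub_sub_nonneg {α : Fin n → ℤ} {c : ℤ} (hα : Monotone α) (hαc : ∀ i j, α i + α j ≤ c) :
    0 ≤ symplecticRhoPairing (fun i => c - α i) - symplecticRhoPairing α := by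
  have h := sum_sub_add_sum_neg_sub_eq (fun i => α i - c) c
  rw [symplecticRhoPairing_sub_const] at h
  have e : symplecticRhoPairing (fun i => c - α i) - symplecticRhoPairing α =
      -(2 * (symplecticRhoPairing α - symplecticRhoPairing fun _ : Fin n => c)) - symplecticRhoPairing fun _ : Fin n => c := by
    rw [symplecticRhoPairing_const_sub]; ring
  rw [e, ← h]
  refine add_nonneg (Finset.sum_nonneg fun j _ => Finset.sum_nonneg fun i hi => ?_) (Finset.sum_nonneg fun p _ => ?_)
  · have := hα (Finset.mem_Iio.1 hi).le
    linarith
  · have := hαc p.1 p.2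
    linarith

variable [Valued K ℤᵐ⁰] {ϖ : K}

/-- **THE MODULUS INDEX OF THE BOREL OF `GSp_{2n}` EVALUATED**: for `λ = (α, c) ∈ ℤⁿ × ℤ` ANTIDOMINANT (`α` monotone,
`αᵢ + αⱼ ≤ c`) and `t_λ = t(c, α - c·1) = diag(ϖ^α; ϖ^{c-α})`,

  `[B(𝒪) : B(𝒪) ∩ t_λB(𝒪)t_λ⁻¹] = [B(𝒪) : t_λB(𝒪)t_λ⁻¹] = q^{⟨ρ, c·1 - α⟩ - ⟨ρ, α⟩}`

(`= ∏_{i<j} q^{αⱼ-αᵢ} · ∏_{i≤j} q^{c-αᵢ-αⱼ} = q^{c·n(n+1)/2 - 2⟨ρ,α⟩}`; `w₀α = c·1 - α`): the index left abstract in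
`SymplecticSimilitudeSatakeTransformDuality` (g44-#6).  E.g. `GL₂ = GSp₂`, `λ = (0, 1)`, `t_λ = diag(1, ϖ)`: index `q`.
[cite: AndrianovZhuravlev1995, Ch. 3 §3 Lemma 3.6, §3.3 Thm. 3.30] [cite: Macdonald1995, Ch. V (2.6), (2.9)]
[cite: CartierCorvallis1979, §I.3, §IV (4.2)] [cite: Kottwitz1992, §7 Lemma 7.4] -/
theorem relIndex_conjAct_similitudeBorelInt_eq_pow (hϖ : Valued.v ϖ = WithZero.exp (-1 : ℤ)) [NeZero n] [Finite 𝓀[K]]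
    {α : Fin n → ℤ} {c : ℤ} (hα : Monotone α) (hαc : ∀ i j, α i + α j ≤ c) :
    (toConjAct (similitudeTorusElt (uniformizer_ne_zero hϖ) c (fun i => α i - c) : symplecticSimilitudeGroup (Fin n) K) •
          (symplecticSimilitudeBorel n K ⊓ symplecticSimilitudeInt (Fin n) K)).relIndex
        (symplecticSimilitudeBorel n K ⊓ symplecticSimilitudeInt (Fin n) K) =
      Nat.card 𝓀[K] ^ (symplecticRhoPairing (fun i => c - α i) - symplecticRhoPairing α).toNat := by
  obtain ⟨t, ht⟩ := exists_coe_eq_diagonal_zpow_symplectic (K := K) (uniformizer_ne_zero hϖ) (fun i => α i - c)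
  rw [relIndex_conjAct_similitudeBorelInt_eq_relIndex_map_blockRescale hϖ ht c,
    relIndex_map_blockRescale_conjAct_borelInt_eq_pow hϖ ht (fun i j hij => sub_le_sub_right (hα hij) c)
      (fun i j _ => by have := hαc i j; linarith),
    symplecticRhoPairing_sub_const, symplecticRhoPairing_const_sub]
  congr 2
  ring

/-- **`[t_λB(𝒪)t_λ⁻¹ : B(𝒪) ∩ t_λB(𝒪)t_λ⁻¹] = 1`** for antidominant `λ` (the tree's `conjAct_smul_inf_le_similitude`).
[cite: BruhatTits1972, (4.4.4)] [cite: CartierCorvallis1979, §IV (4.2)] -/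
theorem relIndex_similitudeBorelInt_conjAct_eq_one (hϖ : Valued.v ϖ = WithZero.exp (-1 : ℤ)) [NeZero n]
    {α : Fin n → ℤ} {c : ℤ} (hα : Monotone α) (hαc : ∀ i j, α i + α j ≤ c) :
    (symplecticSimilitudeBorel n K ⊓ symplecticSimilitudeInt (Fin n) K).relIndex
        (toConjAct (similitudeTorusElt (uniformizer_ne_zero hϖ) c (fun i => α i - c) : symplecticSimilitudeGroup (Fin n) K) •
          (symplecticSimilitudeBorel n K ⊓ symplecticSimilitudeInt (Fin n) K)) = 1 :=
  Subgroup.relIndex_eq_one.2 (conjAct_smul_inf_le_similitude hϖ hα hαc)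

variable [NeZero n] {R : Type*} [CommRing R]
  [IsHeckeTriple (⊤ : Submonoid (symplecticSimilitudeGroup (Fin n) K)) (symplecticSimilitudeInt (Fin n) K)
    (symplecticSimilitudeInt (Fin n) K)]

/-- **Antidominant coefficients of the counting transform with `q` explicit**: for `α` monotone with `αᵢ + αⱼ ≤ c`,
`𝒮_1(T)_{(α,c)} = q^{⟨ρ, c·1-α⟩ - ⟨ρ, α⟩} · 𝒮_1(T)_{(c·1-α, c)}` for every `T ∈ ℋ(GSp_{2n}(K), GSp_{2n}(𝒪); R)`.
[cite: AndrianovZhuravlev1995, Ch. 3 §3.3 Thm. 3.30] [cite: Laumon1995, (4.1.4)] -/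
theorem coeff_satakeTransform_one_eq_pow_mul_similitude (hϖ : Valued.v ϖ = WithZero.exp (-1 : ℤ)) [Finite 𝓀[K]]
    (T : heckeAlgebra R (symplecticSimilitudeGroup (Fin n) K) (symplecticSimilitudeInt (Fin n) K)) {α : Fin n → ℤ} {c : ℤ}
    (hα : Monotone α) (hαc : ∀ i j, α i + α j ≤ c) :
    ((isIwasawaExponent_similitude hϖ).satakeTransform (1 : Multiplicative ((Fin n → ℤ) × ℤ) →* R) T).coeff (α, c) =
      ((isIwasawaExponent_similitude hϖ).satakeTransform (1 : Multiplicative ((Fin n → ℤ) × ℤ) →* R) T).coeff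
          (fun i => c - α i, c) *
        ((Nat.card 𝓀[K] ^ (symplecticRhoPairing (fun i => c - α i) - symplecticRhoPairing α).toNat : ℕ) : R) := by
  rw [coeff_satakeTransform_one_eq_relIndex_mul_similitude hϖ T hα hαc, relIndex_conjAct_similitudeBorelInt_eq_pow hϖ hα hαc]

end Evaluation

/-! ## §3 The index ratio for every `λ` and the counting duality with `q` explicit -/

section Ratio

variable {n : ℕ} [NeZero n] [Valued K ℤᵐ⁰] {ϖ : K}
  [IsHeckeTriple (⊤ : Submonoid (symplecticSimilitudeGroup (Fin n) K)) (symplecticSimilitudeInt (Fin n) K)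
    (symplecticSimilitudeInt (Fin n) K)]

/-- **THE INDEX RATIO FOR EVERY `λ = (α, c)`**: with `E(λ) = ⟨ρ, c·1-α⟩ - ⟨ρ, α⟩` and `t_λ = t(c, α - c·1)`,
`[t_λB(𝒪)t_λ⁻¹ : B(𝒪) ∩ t_λB(𝒪)t_λ⁻¹] · q^{E(λ)⁺} = [B(𝒪) : B(𝒪) ∩ t_λB(𝒪)t_λ⁻¹] · q^{(-E(λ))⁺}` — the ratio of the two
indices is the modulus `q^{E(λ)}`; from the antidominant evaluation at `λ'` and `λ + λ'` (`λ' = (2C·i, 4Cn + 2C + |c|)`,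
`C = Σ|αᵢ|`) and the multiplicativity of the ratio (`SatakeTransformDuality.relIndex_conj_mul_conj`).
[cite: CartierCorvallis1979, §I.3, §IV (4.2)] [cite: AndrianovZhuravlev1995, Ch. 3 §3.3 Thm. 3.30] [cite: Laumon1995, (4.1.4)] -/
theorem relIndex_similitudeBorelInt_conjAct_mul_pow_eq (hϖ : Valued.v ϖ = WithZero.exp (-1 : ℤ)) [Finite 𝓀[K]]
    (α : Fin n → ℤ) (c : ℤ) :
    (symplecticSimilitudeBorel n K ⊓ symplecticSimilitudeInt (Fin n) K).relIndex
          (toConjAct (similitudeTorusElt (uniformizer_ne_zero hϖ) c (fun i => α i - c) : symplecticSimilitudeGroup (Fin n) K) •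
            (symplecticSimilitudeBorel n K ⊓ symplecticSimilitudeInt (Fin n) K)) *
        Nat.card 𝓀[K] ^ (symplecticRhoPairing (fun i => c - α i) - symplecticRhoPairing α).toNat =
      (toConjAct (similitudeTorusElt (uniformizer_ne_zero hϖ) c (fun i => α i - c) : symplecticSimilitudeGroup (Fin n) K) •
            (symplecticSimilitudeBorel n K ⊓ symplecticSimilitudeInt (Fin n) K)).relIndex
          (symplecticSimilitudeBorel n K ⊓ symplecticSimilitudeInt (Fin n) K) *
        Nat.card 𝓀[K] ^ (-(symplecticRhoPairing (fun i => c - α i) - symplecticRhoPairing α)).toNat := by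
  have hϖ0 := uniformizer_ne_zero hϖ
  -- an antidominant `λ' = (α', c')` with `λ + λ'` antidominant
  set C : ℤ := ∑ i : Fin n, |α i| with hC
  have hCi : ∀ i, |α i| ≤ C := fun i => Finset.single_le_sum (fun i _ => abs_nonneg (α i)) (Finset.mem_univ i)
  have hC0 : 0 ≤ C := Finset.sum_nonneg fun i _ => abs_nonneg (α i)
  set α' : Fin n → ℤ := fun i => 2 * C * (i : ℕ) with hα'
  set c' : ℤ := 4 * C * n + 2 * C + |c| with hc'
  have hin : ∀ i : Fin n, ((i : ℕ) : ℤ) + 1 ≤ n := fun i => by exact_mod_cast (show (i : ℕ) < n from i.is_lt)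
  have hα'_mono : Monotone α' := fun i j hij => by
    have hij' : ((i : ℕ) : ℤ) ≤ ((j : ℕ) : ℤ) := by exact_mod_cast (show (i : ℕ) ≤ (j : ℕ) from hij)
    simp only [hα']
    nlinarith
  have hα'c : ∀ i j, α' i + α' j ≤ c' := fun i j => by
    have hi := hin i; have hj := hin j; have habs := abs_nonneg c
    simp only [hα', hc']
    nlinarith
  have hsum_mono : Monotone (α + α') := fun i j hij => by
    rcases eq_or_lt_of_le hij with h | h
    · rw [h]
    · have hij' : ((i : ℕ) : ℤ) + 1 ≤ ((j : ℕ) : ℤ) := by exact_mod_cast (show (i : ℕ) < (j : ℕ) from h)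
      simp only [Pi.add_apply, hα']
      have h1 := hCi i; have h2 := hCi j
      have h3 := le_abs_self (α i); have h4 := neg_abs_le (α j)
      nlinarith
  have hsum_c : ∀ i j, (α + α') i + (α + α') j ≤ c + c' := fun i j => by
    have hi := hin i; have hj := hin j
    simp only [Pi.add_apply, hα', hc']
    have h1 := hCi i; have h2 := hCi j; have h3 := le_abs_self (α i); have h4 := le_abs_self (α j)
    have h5 := neg_abs_le c
    nlinarith
  -- the multiplicativity identity at `(t_λ, t_λ')`
  have key := IsIwasawaExponent.relIndex_conj_mul_conj (K := symplecticSimilitudeInt (Fin n) K)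
    (similitudeTorusElt_mem_symplecticSimilitudeBorel hϖ0 c (fun i => α i - c))
    (similitudeTorusElt_mem_symplecticSimilitudeBorel hϖ0 c' (fun i => α' i - c'))
  have hmul : (similitudeTorusElt hϖ0 c (fun i => α i - c) : symplecticSimilitudeGroup (Fin n) K) *
      similitudeTorusElt hϖ0 c' (fun i => α' i - c') = similitudeTorusElt hϖ0 (c + c') (fun i => (α + α') i - (c + c')) := by
    rw [similitudeTorusElt_mul]
    congr 1
    funext i
    simp only [Pi.add_apply]
    ring
  rw [hmul, relIndex_conjAct_similitudeBorelInt_eq_pow hϖ hsum_mono hsum_c,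
    relIndex_similitudeBorelInt_conjAct_eq_one hϖ hα'_mono hα'c, relIndex_similitudeBorelInt_conjAct_eq_one hϖ hsum_mono hsum_c,
    relIndex_conjAct_similitudeBorelInt_eq_pow hϖ hα'_mono hα'c, mul_one, one_mul] at key
  -- `key : q^{(E + E')⁺} · D₁ = D₂ · q^{E'⁺}`, `E' ≥ 0`, `E + E' ≥ 0`
  have hq : 0 < Nat.card 𝓀[K] := Nat.card_pos
  have hE' := symplecticRhoPairing_const_sub_sub_nonneg hα'_mono hα'c
  have hEE' := symplecticRhoPairing_const_sub_sub_nonneg hsum_mono hsum_c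
  have hadd : symplecticRhoPairing (fun i => c + c' - (α + α') i) - symplecticRhoPairing (α + α') =
      (symplecticRhoPairing (fun i => c - α i) - symplecticRhoPairing α) +
        (symplecticRhoPairing (fun i => c' - α' i) - symplecticRhoPairing α') := by
    rw [symplecticRhoPairing_const_sub, symplecticRhoPairing_const_sub, symplecticRhoPairing_const_sub,
      symplecticRhoPairing_const_add, symplecticRhoPairing_add]
    ring
  rw [hadd] at key hEE'
  set E := symplecticRhoPairing (fun i => c - α i) - symplecticRhoPairing α with hE
  set E' := symplecticRhoPairing (fun i => c' - α' i) - symplecticRhoPairing α' with hE'def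
  set D₁ := (symplecticSimilitudeBorel n K ⊓ symplecticSimilitudeInt (Fin n) K).relIndex
    (toConjAct (similitudeTorusElt hϖ0 c (fun i => α i - c) : symplecticSimilitudeGroup (Fin n) K) •
      (symplecticSimilitudeBorel n K ⊓ symplecticSimilitudeInt (Fin n) K)) with hD₁
  set D₂ := (toConjAct (similitudeTorusElt hϖ0 c (fun i => α i - c) : symplecticSimilitudeGroup (Fin n) K) •
      (symplecticSimilitudeBorel n K ⊓ symplecticSimilitudeInt (Fin n) K)).relIndex
    (symplecticSimilitudeBorel n K ⊓ symplecticSimilitudeInt (Fin n) K) with hD₂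
  rcases le_or_gt 0 E with hE0 | hE0
  · rw [Int.toNat_of_nonpos (by omega : -E ≤ 0), pow_zero, mul_one]
    have e : (E + E').toNat = E.toNat + E'.toNat := by omega
    rw [e, pow_add] at key
    have hqB : Nat.card 𝓀[K] ^ E'.toNat ≠ 0 := pow_ne_zero _ hq.ne'
    refine mul_right_cancel₀ hqB ?_
    calc D₁ * Nat.card 𝓀[K] ^ E.toNat * Nat.card 𝓀[K] ^ E'.toNat
        = Nat.card 𝓀[K] ^ E.toNat * Nat.card 𝓀[K] ^ E'.toNat * D₁ := by ring
      _ = D₂ * Nat.card 𝓀[K] ^ E'.toNat := key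
  · rw [Int.toNat_of_nonpos hE0.le, pow_zero, mul_one]
    have e : E'.toNat = (E + E').toNat + (-E).toNat := by omega
    rw [e, pow_add, ← mul_assoc] at key
    have hqA : Nat.card 𝓀[K] ^ (E + E').toNat ≠ 0 := pow_ne_zero _ hq.ne'
    refine mul_right_cancel₀ hqA ?_
    calc D₁ * Nat.card 𝓀[K] ^ (E + E').toNat = Nat.card 𝓀[K] ^ (E + E').toNat * D₁ := mul_comm _ _
      _ = D₂ * Nat.card 𝓀[K] ^ (E + E').toNat * Nat.card 𝓀[K] ^ (-E).toNat := key
      _ = D₂ * Nat.card 𝓀[K] ^ (-E).toNat * Nat.card 𝓀[K] ^ (E + E').toNat := by ring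

/-- **DUALITY FOR `GSp_{2n}` WITH `q` EXPLICIT** (counting version): for every `g`, every `λ = (α, c)`,
`#{γ ∈ K₀gK₀/K₀ : (a,c)(γ) = λ} · q^{(-E(λ))⁺} = #{γ ∈ K₀gK₀/K₀ : (a,c)(γ) = w₀λ} · q^{E(λ)⁺}`, `w₀λ = (c·1 - α, c)`,
`E(λ) = ⟨ρ, c·1-α⟩ - ⟨ρ, α⟩`. [cite: AndrianovZhuravlev1995, Ch. 3 §3.3 Thm. 3.30] [cite: CartierCorvallis1979, §IV (4.2), Thm. 4.1] -/
theorem card_filter_similitudeIwasawaExp_mul_pow_eq (hϖ : Valued.v ϖ = WithZero.exp (-1 : ℤ)) [Finite 𝓀[K]]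
    (g : symplecticSimilitudeGroup (Fin n) K) (α : Fin n → ℤ) (c : ℤ)
    [DecidablePred fun γ : symplecticSimilitudeGroup (Fin n) K ⧸ symplecticSimilitudeInt (Fin n) K =>
      similitudeIwasawaExp hϖ γ.out = (α, c)]
    [DecidablePred fun γ : symplecticSimilitudeGroup (Fin n) K ⧸ symplecticSimilitudeInt (Fin n) K =>
      similitudeIwasawaExp hϖ γ.out = (fun i => c - α i, c)] :
    ((finite_orbit_quotient (symplecticSimilitudeInt (Fin n) K) g).toFinset.filter
          (fun γ => similitudeIwasawaExp hϖ γ.out = (α, c))).card *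
        Nat.card 𝓀[K] ^ (-(symplecticRhoPairing (fun i => c - α i) - symplecticRhoPairing α)).toNat =
      ((finite_orbit_quotient (symplecticSimilitudeInt (Fin n) K) g).toFinset.filter
          (fun γ => similitudeIwasawaExp hϖ γ.out = (fun i => c - α i, c))).card *
        Nat.card 𝓀[K] ^ (symplecticRhoPairing (fun i => c - α i) - symplecticRhoPairing α).toNat := by
  have hD := card_filter_similitudeIwasawaExp_mul_relIndex_eq hϖ g α c
  have hR := relIndex_similitudeBorelInt_conjAct_mul_pow_eq hϖ α c
  have htP := similitudeTorusElt_mem_symplecticSimilitudeBorel (K := K) (uniformizer_ne_zero hϖ) c (fun i => α i - c)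
  have hi₂ := IsIwasawaExponent.relIndex_conj_ne_zero (K := symplecticSimilitudeInt (Fin n) K) htP
  have hi₁ := IsIwasawaExponent.relIndex_conj_ne_zero' (K := symplecticSimilitudeInt (Fin n) K) htP
  set N₁ := ((finite_orbit_quotient (symplecticSimilitudeInt (Fin n) K) g).toFinset.filter
    (fun γ => similitudeIwasawaExp hϖ γ.out = (α, c))).card
  set N₂ := ((finite_orbit_quotient (symplecticSimilitudeInt (Fin n) K) g).toFinset.filter
    (fun γ => similitudeIwasawaExp hϖ γ.out = (fun i => c - α i, c))).card
  set i₁ := (symplecticSimilitudeBorel n K ⊓ symplecticSimilitudeInt (Fin n) K).relIndex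
    (toConjAct (similitudeTorusElt (uniformizer_ne_zero hϖ) c (fun i => α i - c) : symplecticSimilitudeGroup (Fin n) K) •
      (symplecticSimilitudeBorel n K ⊓ symplecticSimilitudeInt (Fin n) K))
  set i₂ := (toConjAct (similitudeTorusElt (uniformizer_ne_zero hϖ) c (fun i => α i - c) : symplecticSimilitudeGroup (Fin n) K) •
      (symplecticSimilitudeBorel n K ⊓ symplecticSimilitudeInt (Fin n) K)).relIndex
    (symplecticSimilitudeBorel n K ⊓ symplecticSimilitudeInt (Fin n) K)
  set qp := Nat.card 𝓀[K] ^ (symplecticRhoPairing (fun i => c - α i) - symplecticRhoPairing α).toNat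
  set qm := Nat.card 𝓀[K] ^ (-(symplecticRhoPairing (fun i => c - α i) - symplecticRhoPairing α)).toNat
  have h : N₁ * qm * (i₁ * i₂) = N₂ * qp * (i₁ * i₂) := by
    calc N₁ * qm * (i₁ * i₂) = (N₁ * i₁) * (i₂ * qm) := by ring
      _ = (N₂ * i₂) * (i₁ * qp) := by rw [hD, ← hR]
      _ = N₂ * qp * (i₁ * i₂) := by ring
  exact mul_right_cancel₀ (mul_ne_zero hi₁ hi₂) h

/-- **The dominant-extreme count of `K₀ t(m,a) K₀` evaluated**: for `a` antitone with `m + 2aᵢ ≥ 0` (the Cartan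
representative `t(m, a) = diag(ϖ^m ϖ^a; ϖ^{-a})` with dominant exponent `λ₀ = (m·1 + a, m)`),
`#{γ ∈ K₀ t(m,a) K₀/K₀ : (a,c)(γ) = w₀λ₀ = (-a, m)} = q^{2⟨ρ, a⟩ + ⟨ρ, m·1⟩}` — from `#{(a,c)(γ) = λ₀} = 1` (Bruhat–Tits
(4.4.4) (ii)) and the duality; e.g. `GSp₄ ⊇ K₀ diag(p,p,1,1) K₀ = T(p)`: `(m, a) = (1, 0)`, `q^{⟨ρ,1·1⟩} = q³` cosets at the
extreme `(0, 1)`. [cite: AndrianovZhuravlev1995, Ch. 3 §3 Lemma 3.6, §3.3 Thm. 3.30] [cite: BruhatTits1972, Prop. (4.4.4)]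
[cite: Macdonald1995, Ch. V (2.6)–(2.9)] -/
theorem card_filter_similitudeIwasawaExp_orbit_w0_eq_pow (hϖ : Valued.v ϖ = WithZero.exp (-1 : ℤ)) [Finite 𝓀[K]]
    {m : ℤ} {a : Fin n → ℤ} (ha : Antitone a) (hm : ∀ i, 0 ≤ m + 2 * a i)
    [DecidablePred fun γ : symplecticSimilitudeGroup (Fin n) K ⧸ symplecticSimilitudeInt (Fin n) K =>
      similitudeIwasawaExp hϖ γ.out = (fun i => m + a i, m)]
    [DecidablePred fun γ : symplecticSimilitudeGroup (Fin n) K ⧸ symplecticSimilitudeInt (Fin n) K =>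
      similitudeIwasawaExp hϖ γ.out = (fun i => m - (m + a i), m)] :
    ((finite_orbit_quotient (symplecticSimilitudeInt (Fin n) K)
        (similitudeTorusElt (uniformizer_ne_zero hϖ) m a : symplecticSimilitudeGroup (Fin n) K)).toFinset.filter
        fun γ => similitudeIwasawaExp hϖ γ.out = (fun i => m - (m + a i), m)).card =
      Nat.card 𝓀[K] ^ (2 * symplecticRhoPairing a + symplecticRhoPairing (fun _ : Fin n => m)).toNat := by
  have h := card_filter_similitudeIwasawaExp_mul_pow_eq hϖ
    (similitudeTorusElt (uniformizer_ne_zero hϖ) m a : symplecticSimilitudeGroup (Fin n) K) (fun i => m + a i) m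
  beta_reduce at h
  rw [card_filter_similitudeIwasawaExp_orbit_eq_one hϖ ha hm, one_mul] at h
  -- the exponent `E(λ₀) = -(2⟨ρ,a⟩ + ⟨ρ,m·1⟩) ≤ 0`
  have hE : symplecticRhoPairing (fun i => m - (m + a i)) - symplecticRhoPairing (fun i => m + a i) =
      -(2 * symplecticRhoPairing a + symplecticRhoPairing (fun _ : Fin n => m)) := by
    have e1 : (fun i => m - (m + a i)) = -a := funext fun i => by simp only [Pi.neg_apply]; ring
    have e2 : (fun i => m + a i) = (fun _ : Fin n => m) + a := funext fun i => by simp only [Pi.add_apply]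
    rw [e1, e2, symplecticRhoPairing_neg, symplecticRhoPairing_add]
    ring
  have hpos : 0 ≤ 2 * symplecticRhoPairing a + symplecticRhoPairing (fun _ : Fin n => m) := by
    have e : 2 * symplecticRhoPairing a + symplecticRhoPairing (fun _ : Fin n => m) = symplecticRhoPairing (a + a + fun _ => m) := by
      rw [symplecticRhoPairing_add, symplecticRhoPairing_add]; ring
    rw [e]
    exact Finset.sum_nonneg fun i _ => mul_nonneg (by have := i.is_lt; omega)
      (by simp only [Pi.add_apply]; have := hm i; omega)
  rw [hE, neg_neg, Int.toNat_of_nonpos (show -(2 * symplecticRhoPairing a + symplecticRhoPairing fun _ : Fin n => m) ≤ 0 by omega),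
    pow_zero, mul_one] at h
  exact h.symm

end Ratio

/-! ## §4 The exact `w₀`-invariance of the Satake transform of `GSp_{2n}` -/

section Satake

variable {n : ℕ} [NeZero n] [Valued K ℤᵐ⁰] {ϖ : K} {R : Type*} [CommRing R] (hϖ : Valued.v ϖ = WithZero.exp (-1 : ℤ))
  [Finite 𝓀[K]]
  [IsHeckeTriple (⊤ : Submonoid (symplecticSimilitudeGroup (Fin n) K)) (symplecticSimilitudeInt (Fin n) K)
    (symplecticSimilitudeInt (Fin n) K)]
include hϖ

/-- **`𝒮_q(T_g)_{(c·1-α, c)} = 𝒮_q(T_g)_{(α, c)}`** for `q ∈ Rˣ` the residue cardinality: the coefficient formula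
`𝒮_q(T_g)_{(α,c)} = #{(a,c)(γ) = (α,c)} q^{⟨ρ,α⟩}` and the counting duality; the weight `q^{⟨ρ,α⟩}` of Andrianov–Zhuravlev
(`= δ^{1/2}|r|^{-n(n+1)/4}`) absorbs the modulus EXACTLY: `⟨ρ, w₀α⟩ - ⟨ρ, α⟩ = E(λ)`.
[cite: AndrianovZhuravlev1995, Ch. 3 §3.3 (3.44)–(3.49), Thm. 3.30] [cite: CartierCorvallis1979, §IV (4.2), Thm. 4.1] -/
theorem coeff_similitudeSatakeTransform_doubleCosetOperator_w0 (q : Rˣ) (hq : (q : R) = Nat.card 𝓀[K])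
    (g : symplecticSimilitudeGroup (Fin n) K) (α : Fin n → ℤ) (c : ℤ) :
    (similitudeSatakeTransform hϖ q (heckeAlgebra.doubleCosetOperator (symplecticSimilitudeInt (Fin n) K) g)).coeff
        (fun i => c - α i, c) =
      (similitudeSatakeTransform hϖ q (heckeAlgebra.doubleCosetOperator (symplecticSimilitudeInt (Fin n) K) g)).coeff (α, c) := by
  classical
  have hC := card_filter_similitudeIwasawaExp_mul_pow_eq hϖ g α c
  set E := symplecticRhoPairing (fun i => c - α i) - symplecticRhoPairing α with hE
  have hC' : (((finite_orbit_quotient (symplecticSimilitudeInt (Fin n) K) g).toFinset.filter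
        (fun γ => similitudeIwasawaExp hϖ γ.out = (α, c))).card : R) * ((q ^ ((-E).toNat : ℤ) : Rˣ) : R) =
      (((finite_orbit_quotient (symplecticSimilitudeInt (Fin n) K) g).toFinset.filter
        (fun γ => similitudeIwasawaExp hϖ γ.out = (fun i => c - α i, c))).card : R) * ((q ^ (E.toNat : ℤ) : Rˣ) : R) := by
    have h := congrArg (Nat.cast : ℕ → R) hC
    push_cast at h
    rwa [← hq, ← Units.val_pow_eq_pow_val, ← Units.val_pow_eq_pow_val, ← zpow_natCast, ← zpow_natCast] at h
  rw [coeff_similitudeSatakeTransform_doubleCosetOperator, coeff_similitudeSatakeTransform_doubleCosetOperator]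
  dsimp only
  have hρ : symplecticRhoPairing (fun i => c - α i) = symplecticRhoPairing α + E := by rw [hE]; ring
  have e1 : q ^ symplecticRhoPairing (fun i => c - α i) =
      q ^ (E.toNat : ℤ) * q ^ (symplecticRhoPairing α + E - (E.toNat : ℤ)) := by
    rw [← _root_.zpow_add, hρ]; congr 1; ring
  have e2 : q ^ symplecticRhoPairing α = q ^ ((-E).toNat : ℤ) * q ^ (symplecticRhoPairing α + E - (E.toNat : ℤ)) := by
    rw [← _root_.zpow_add]; congr 1; omega
  rw [e1, e2, Units.val_mul, Units.val_mul, ← mul_assoc, ← mul_assoc, hC']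

/-- **THE `w₀`-INVARIANCE OF THE SATAKE TRANSFORM OF `GSp_{2n}`: `𝒮_q(T)_{(c·1-α, c)} = 𝒮_q(T)_{(α, c)}` for EVERY `n ≥ 1`,
every `T ∈ ℋ(GSp_{2n}(K), GSp_{2n}(𝒪); R)` and every `(α, c) ∈ ℤⁿ × ℤ`**, when `q ∈ Rˣ` is the residue cardinality — the
longest Weyl element `w₀ : (α, c) ↦ (c·1 - α, c)` of `GSp_{2n}` fixes the image of Andrianov–Zhuravlev's spherical map `Ω`
(the `w₀`-part of «`Ω(L) = ℚ[x₀, …, xₙ]^W`», A–Z Thm. 3.30), over any commutative ring `R` with `q ∈ Rˣ`.  By linearity from the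
double-coset operators. [cite: AndrianovZhuravlev1995, Ch. 3 §3.3 Thm. 3.30] [cite: CartierCorvallis1979, §IV Thm. 4.1]
[cite: Satake1963, §§6–7] -/
theorem coeff_similitudeSatakeTransform_w0 (q : Rˣ) (hq : (q : R) = Nat.card 𝓀[K])
    (T : heckeAlgebra R (symplecticSimilitudeGroup (Fin n) K) (symplecticSimilitudeInt (Fin n) K)) (α : Fin n → ℤ) (c : ℤ) :
    (similitudeSatakeTransform hϖ q T).coeff (fun i => c - α i, c) = (similitudeSatakeTransform hϖ q T).coeff (α, c) := by
  have hT := heckeAlgebra.mem_span_range_doubleCosetOperator (symplecticSimilitudeInt (Fin n) K) T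
  induction hT using Submodule.span_induction with
  | mem S hS =>
    obtain ⟨g, rfl⟩ := hS
    exact coeff_similitudeSatakeTransform_doubleCosetOperator_w0 hϖ q hq g α c
  | zero => simp
  | add S S' _ _ hS hS' =>
    rw [map_add, AddMonoidAlgebra.coeff_add, Finsupp.add_apply, Finsupp.add_apply, hS, hS']
  | smul r S _ hS =>
    rw [map_smul, AddMonoidAlgebra.coeff_smul, Finsupp.smul_apply, Finsupp.smul_apply, hS]

/-- The Satake image of `ℋ(GSp_{2n})` lies in the `w₀`-invariants of `R[ℤⁿ × ℤ]`. [cite: AndrianovZhuravlev1995, Ch. 3 §3.3 Thm. 3.30]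
[cite: CartierCorvallis1979, §IV Thm. 4.1] -/
theorem range_similitudeSatakeTransform_subset (q : Rˣ) (hq : (q : R) = Nat.card 𝓀[K]) :
    Set.range (similitudeSatakeTransform (n := n) (R := R) hϖ q) ⊆
      {f | ∀ (α : Fin n → ℤ) (c : ℤ), f.coeff (fun i => c - α i, c) = f.coeff (α, c)} := by
  rintro _ ⟨T, rfl⟩ α c
  exact coeff_similitudeSatakeTransform_w0 hϖ q hq T α c

end Satake

end Literature.NumberTheory.Automorphic.SymplecticCartan

end
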